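import Literature.NumberTheory.EllipticCurves.KugaSatoSchollProjectorFrobInfty
import HarnessLib

/-!
# The `±`-eigenspaces of `F_∞` on the `ε`-part of `Hⁱ_B(W|_ℚ)`

Topic: `Literature/NumberTheory/EllipticCurves`. Complement to
`KugaSatoSchollProjectorFrobInfty.lean`: for a Kuga–Sato variety `V` over `K ∋ ζ_N`, the infinite
Frobenius `F_∞` of the `ℚ`-scheme `W|_ℚ` is an involution of `Hⁱ_B(W|_ℚ) = Hⁱ(W|_ℚ(ℂ); ℚ)`
(`ModularForms.frobInfty_comp_frobInfty`) which commutes with Scholl's projector `Π_ε`, hence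
preserves the `ε`-part `schollPartRat V i` (`frobInfty_mem_schollPartRat`). Over `ℚ` (where `2`
is invertible) an involution splits every stable subspace into its `±1`-eigenspaces; this file
records that splitting:

* generic (`section Involution`): for a `ℚ`-linear involution `F` of `H` and an `F`-stable
  submodule `P`, the eigen-submodules `P⁺ = {x ∈ P | F x = x}`, `P⁻ = {x ∈ P | F x = -x}`
  (`invPlusPart`, `invMinusPart`) satisfy `P⁺ ⊓ P⁻ = ⊥` and `P⁺ ⊔ P⁻ = P`
  (`x = (x + F x)/2 + (x - F x)/2`);
* `KugaSatoVariety.schollPartRatPlus V i`, `schollPartRatMinus V i` — the `±`-eigenspaces of `F_∞`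
  on `Π_ε Hⁱ_B(W|_ℚ)`, with `schollPartRatPlus_inf_schollPartRatMinus = ⊥` and
  `schollPartRatPlus_sup_schollPartRatMinus = schollPartRat`.

On Deninger–Scholl's sign convention ((2.2), p. 151 of the volume): their `H_B^p(X, Λ(q))^+` is the
fixed module of `F̄_∞^* = F_∞^* ∘ (complex conjugation on the coefficients)` on
`H_B^p(X_ℂ, Λ(q))`, `Λ(q) = (2πi)^q Λ ⊂ ℂ`, `1/2 ∈ Λ`; since coefficient conjugation acts on
`(2πi)^q ℝ` by `(-1)^q`, that `+`-part is `(2πi)^q` times the `(-1)^q`-EIGENSPACE of `F_∞^*` on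
`H_B^p(X(ℂ); ℝ)`. Accordingly BOTH eigenspaces are defined here (over `ℚ`); the space
`H_B^{k+1}(X̄̄_nᵏ, ℝ(k+l+1))^+` of (5.4) corresponds to `schollPartRatPlus` or `schollPartRatMinus`
tensored with `ℝ` according to the parity of `k + l + 1`. Nothing is asserted about dimensions.
No named facts; hypothesis `[IsCommMonObj V.curve.E]` as in the companion files.

## References

* C. Deninger, A. J. Scholl, *The Beilinson conjectures*, in *L-functions and Arithmetic*,
  LMS LNS 153 (1991), (2.2) (p. 151), 5.3 (i), (5.4) (pp. 167–168). [DeningerScholl1991]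
-/

open CategoryTheory Limits AlgebraicGeometry MonoidalCategory CartesianMonoidalCategory
open scoped MonObj MatrixGroups

noncomputable section

namespace Literature.NumberTheory.EllipticCurves

/-! ### A `ℚ`-linear involution splits a stable submodule into `±1`-eigenspaces -/

section Involution

variable {H : Type*} [AddCommGroup H] [Module ℚ H] (P : Submodule ℚ H) (F : H →ₗ[ℚ] H)

/-- The `+1`-eigenspace of `F` inside `P`: `P⁺ = {x ∈ P | F x = x}`. [folklore] -/
def invPlusPart : Submodule ℚ H :=
  P ⊓ LinearMap.eqLocus F LinearMap.id

/-- The `-1`-eigenspace of `F` inside `P`: `P⁻ = {x ∈ P | F x = -x}`. [folklore] -/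
def invMinusPart : Submodule ℚ H :=
  P ⊓ LinearMap.eqLocus F (-LinearMap.id)

/-- Membership in `P⁺`. [folklore] -/
theorem mem_invPlusPart_iff (x : H) : x ∈ invPlusPart P F ↔ x ∈ P ∧ F x = x := by
  simp only [invPlusPart, Submodule.mem_inf, LinearMap.mem_eqLocus, LinearMap.id_apply]

/-- Membership in `P⁻`. [folklore] -/
theorem mem_invMinusPart_iff (x : H) : x ∈ invMinusPart P F ↔ x ∈ P ∧ F x = -x := by
  simp only [invMinusPart, Submodule.mem_inf, LinearMap.mem_eqLocus, LinearMap.neg_apply,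
    LinearMap.id_apply]

/-- `P⁺ ≤ P`. [folklore] -/
theorem invPlusPart_le : invPlusPart P F ≤ P :=
  inf_le_left

/-- `P⁻ ≤ P`. [folklore] -/
theorem invMinusPart_le : invMinusPart P F ≤ P :=
  inf_le_left

/-- **`P⁺ ⊓ P⁻ = ⊥`** (over `ℚ`: `x = -x` forces `x = 0`). [folklore] -/
theorem invPlusPart_inf_invMinusPart : invPlusPart P F ⊓ invMinusPart P F = ⊥ := by
  rw [Submodule.eq_bot_iff]
  intro x hx
  obtain ⟨hp, hm⟩ := Submodule.mem_inf.mp hx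
  have h1 := ((mem_invPlusPart_iff P F x).mp hp).2
  have h2 := ((mem_invMinusPart_iff P F x).mp hm).2
  have h3 : (2 : ℚ) • x = 0 := by
    rw [two_smul]
    nth_rw 2 [← h1]
    rw [h2, add_neg_cancel]
  exact (smul_eq_zero.mp h3).resolve_left (by norm_num)

variable {P F}

/-- For `x ∈ P`, `P` stable under the involution `F`: `x + F x ∈ P⁺`. [folklore] -/
theorem add_apply_mem_invPlusPart (hF : F ∘ₗ F = LinearMap.id) (hP : ∀ x ∈ P, F x ∈ P)
    {x : H} (hx : x ∈ P) : x + F x ∈ invPlusPart P F := by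
  refine (mem_invPlusPart_iff P F _).mpr ⟨P.add_mem hx (hP x hx), ?_⟩
  rw [map_add, ← LinearMap.comp_apply, hF, LinearMap.id_apply, add_comm]

/-- For `x ∈ P`, `P` stable under the involution `F`: `x - F x ∈ P⁻`. [folklore] -/
theorem sub_apply_mem_invMinusPart (hF : F ∘ₗ F = LinearMap.id) (hP : ∀ x ∈ P, F x ∈ P)
    {x : H} (hx : x ∈ P) : x - F x ∈ invMinusPart P F := by
  refine (mem_invMinusPart_iff P F _).mpr ⟨P.sub_mem hx (hP x hx), ?_⟩
  rw [map_sub, ← LinearMap.comp_apply, hF, LinearMap.id_apply, neg_sub]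

variable (P F) in
/-- **`P⁺ ⊔ P⁻ = P`** for an `F`-stable `P` and an involution `F` (over `ℚ`:
`x = ½ (x + F x) + ½ (x - F x)`). [folklore] -/
theorem invPlusPart_sup_invMinusPart (hF : F ∘ₗ F = LinearMap.id) (hP : ∀ x ∈ P, F x ∈ P) :
    invPlusPart P F ⊔ invMinusPart P F = P := by
  apply le_antisymm (sup_le (invPlusPart_le P F) (invMinusPart_le P F))
  intro x hx
  have hdec : x = (1 / 2 : ℚ) • (x + F x) + (1 / 2 : ℚ) • (x - F x) := by
    rw [← smul_add, add_add_sub_cancel, ← two_smul ℚ x, smul_smul]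
    norm_num
  rw [hdec]
  exact Submodule.add_mem _
    (Submodule.mem_sup_left (Submodule.smul_mem _ _ (add_apply_mem_invPlusPart hF hP hx)))
    (Submodule.mem_sup_right (Submodule.smul_mem _ _ (sub_apply_mem_invMinusPart hF hP hx)))

/-- `F` is the identity on `P⁺`. [folklore] -/
theorem apply_of_mem_invPlusPart {x : H} (hx : x ∈ invPlusPart P F) : F x = x :=
  ((mem_invPlusPart_iff P F x).mp hx).2

/-- `F` is `-1` on `P⁻`. [folklore] -/
theorem apply_of_mem_invMinusPart {x : H} (hx : x ∈ invMinusPart P F) : F x = -x :=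
  ((mem_invMinusPart_iff P F x).mp hx).2

end Involution

namespace KugaSatoVariety

open Literature.AlgebraicGeometry.Motives Literature.NumberTheory.EllipticCurves.ModularForms

variable {K : Type} [Field K] [CharZero K] {m N : ℕ} (V : KugaSatoVariety K m N)

/-! ### The `±`-eigenspaces of `F_∞` on `Π_ε Hⁱ_B(W|_ℚ)` -/

/-- **The `+1`-eigenspace of `F_∞` on the `ε`-part of `Hⁱ_B(W|_ℚ)`**:
`{x ∈ Π_ε Hⁱ_B(W|_ℚ) | F_∞ x = x}` (Deninger–Scholl (2.2): the `±`-parts under the infinite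
Frobenius; see the module docstring for the comparison with their `H_B(X, Λ(q))^+`).
[cite: DeningerScholl1991, (2.2)] -/
def schollPartRatPlus [NeZero N] [IsCommMonObj V.curve.E] (i : ℕ) :
    Submodule ℚ (bettiCohomology (V.W.restrictScalars ℚ) i) :=
  invPlusPart (V.schollPartRat i) (frobInfty (V.W.restrictScalars ℚ) i)

/-- **The `-1`-eigenspace of `F_∞` on the `ε`-part of `Hⁱ_B(W|_ℚ)`**:
`{x ∈ Π_ε Hⁱ_B(W|_ℚ) | F_∞ x = -x}`. [cite: DeningerScholl1991, (2.2)] -/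
def schollPartRatMinus [NeZero N] [IsCommMonObj V.curve.E] (i : ℕ) :
    Submodule ℚ (bettiCohomology (V.W.restrictScalars ℚ) i) :=
  invMinusPart (V.schollPartRat i) (frobInfty (V.W.restrictScalars ℚ) i)

/-- Membership in `schollPartRatPlus`. [folklore] -/
theorem mem_schollPartRatPlus_iff [NeZero N] [IsCommMonObj V.curve.E] (i : ℕ)
    (x : bettiCohomology (V.W.restrictScalars ℚ) i) :
    x ∈ V.schollPartRatPlus i ↔ x ∈ V.schollPartRat i ∧ frobInfty _ i x = x :=
  mem_invPlusPart_iff (V.schollPartRat i) _ x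

/-- Membership in `schollPartRatMinus`. [folklore] -/
theorem mem_schollPartRatMinus_iff [NeZero N] [IsCommMonObj V.curve.E] (i : ℕ)
    (x : bettiCohomology (V.W.restrictScalars ℚ) i) :
    x ∈ V.schollPartRatMinus i ↔ x ∈ V.schollPartRat i ∧ frobInfty _ i x = -x :=
  mem_invMinusPart_iff (V.schollPartRat i) _ x

/-- `schollPartRatPlus ≤ schollPartRat`. [folklore] -/
theorem schollPartRatPlus_le [NeZero N] [IsCommMonObj V.curve.E] (i : ℕ) :
    V.schollPartRatPlus i ≤ V.schollPartRat i :=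
  invPlusPart_le (V.schollPartRat i) _

/-- `schollPartRatMinus ≤ schollPartRat`. [folklore] -/
theorem schollPartRatMinus_le [NeZero N] [IsCommMonObj V.curve.E] (i : ℕ) :
    V.schollPartRatMinus i ≤ V.schollPartRat i :=
  invMinusPart_le (V.schollPartRat i) _

/-- **The `±`-eigenspaces of `F_∞` on the `ε`-part meet trivially.** [cite: DeningerScholl1991, (2.2)] -/
theorem schollPartRatPlus_inf_schollPartRatMinus [NeZero N] [IsCommMonObj V.curve.E] (i : ℕ) :
    V.schollPartRatPlus i ⊓ V.schollPartRatMinus i = ⊥ :=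
  invPlusPart_inf_invMinusPart (V.schollPartRat i) _

/-- **The `ε`-part is the sum of the `±`-eigenspaces of `F_∞`**: `F_∞` is an involution
(`ModularForms.frobInfty_comp_frobInfty`) preserving the `ε`-part (`frobInfty_mem_schollPartRat`,
because `Π_ε` is defined over `ℚ`), and `2` is invertible in `ℚ`. [cite: DeningerScholl1991, (2.2)] -/
theorem schollPartRatPlus_sup_schollPartRatMinus [NeZero N] [IsCommMonObj V.curve.E] (i : ℕ) :
    V.schollPartRatPlus i ⊔ V.schollPartRatMinus i = V.schollPartRat i :=
  invPlusPart_sup_invMinusPart (V.schollPartRat i) _ (frobInfty_comp_frobInfty _ i)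
    (fun _ hx => V.frobInfty_mem_schollPartRat hx)

/-- The `±`-eigenspaces of `F_∞` on the `ε`-part are complementary inside it (as submodules of the
`ε`-part). [cite: DeningerScholl1991, (2.2)] -/
theorem isCompl_schollPartRatPlus_schollPartRatMinus [NeZero N] [IsCommMonObj V.curve.E] (i : ℕ) :
    IsCompl ((V.schollPartRatPlus i).comap (V.schollPartRat i).subtype)
      ((V.schollPartRatMinus i).comap (V.schollPartRat i).subtype) := by
  constructor
  · rw [disjoint_iff, ← Submodule.comap_inf, schollPartRatPlus_inf_schollPartRatMinus,
      Submodule.comap_bot, Submodule.ker_subtype]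
  · rw [codisjoint_iff, eq_top_iff]
    rintro ⟨x, hx⟩ -
    have hx' := hx
    rw [← schollPartRatPlus_sup_schollPartRatMinus] at hx'
    obtain ⟨y, hy, z, hz, hyz⟩ := Submodule.mem_sup.mp hx'
    have hy' : y ∈ V.schollPartRat i := V.schollPartRatPlus_le i hy
    have hz' : z ∈ V.schollPartRat i := V.schollPartRatMinus_le i hz
    have heq : (⟨x, hx⟩ : V.schollPartRat i) = ⟨y, hy'⟩ + ⟨z, hz'⟩ := Subtype.ext hyz.symm
    rw [heq]
    exact Submodule.add_mem _ (Submodule.mem_sup_left (Submodule.mem_comap.mpr hy))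
      (Submodule.mem_sup_right (Submodule.mem_comap.mpr hz))

end KugaSatoVariety

end Literature.NumberTheory.EllipticCurves

end
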